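import Literature.AnabelianGeometry.SemiGraphs.ArithIntersectionOfActionAt
import Literature.AnabelianGeometry.SemiGraphs.ArithThm54OfChart
import Literature.AnabelianGeometry.SemiGraphs.ArithChartActionAmple
import Literature.AnabelianGeometry.SemiGraphs.TemperedCompactInVerticialAtBridge
import HarnessLib

/-!
# [SemiAnbd] Thm 5.4 (i) ∧ (ii) for the PRODUCED data — AT ONE GRAPH, and from finite-level data (proof-only twin)

Mochizuki, *Semi-graphs of Anabelioids*, Publ. RIMS **42** (2006) 221–322, §5, Theorem 5.4 (i)(ii) p. 66,
with Thm 3.7 (iii) pp. 40–41 ("Since the semi-graphs `𝔾_j` are all finite …").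
[cite: MochizukiSemiAnbd2006, Thm 5.4 (i)(ii), p. 66]

PROOF-ONLY companion of `ArithThm54OfChart.lean` (abc-iut cell, L3-lead ruling α4-3 (iv), seat
abc-iut-w4-d040): the produced-data umbrella twinned with the per-graph `h : CompactInVerticialAt 𝒢`
(abc-iut-w4-d075) in place of the ∀-graph named fact `CompactInVerticial` (decl suffix `At`), and — through
abc-iut-w4-d075's BRIDGE `compactInVerticialAt_of_finiteLevelData` — the same umbrella with Thm 3.7 (iii)
supplied by FINITE-LEVEL DATA at one chart (`_of_finiteLevelData`): for such `𝒢` Thm 5.4 (i)∧(ii) for the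
data of p. 65 is conditional on producer-side objects only (the packages `L`, `A`, `hconjPair`, `hVc`,
`hBc`, a `FiniteLevelData`) plus the print hypotheses — no named §3 fact remains.  Originals untouched.
No definition, no new named fact; nothing here takes a side on [IUTchIII] Cor. 3.12.
-/

namespace Literature.AnabelianGeometry.SemiGraphs

namespace ProfiniteSemiGraph

open CategoryTheory Topology
open scoped Pointwise

universe v u u''

variable {𝒢 : ProfiniteSemiGraph.{u}} {c : TemperedPiChart 𝒢}
  {Gtp : Type u} [Group Gtp] [TopologicalSpace Gtp] [IsTopologicalGroup Gtp]
  {PA : Type u''} [Group PA] [TopologicalSpace PA] [IsTopologicalGroup PA]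

/-- **[SemiAnbd] Thm 5.4 (i) ∧ (ii) for the produced data, AT ONE GRAPH**: twin of
`arithMaximalCompactStatementI_and_II_ofChart` with `CompactInVerticialAt 𝒢` (Thm 3.7 (iii) at `𝒢`).
[cite: MochizukiSemiAnbd2006, Thm 5.4 (i)(ii), p. 66] -/
theorem arithMaximalCompactStatementI_and_II_ofChartAt [T2Space Gtp] (h : CompactInVerticialAt 𝒢)
    (h𝒢 : 𝒢.Thm37Hypotheses) (hG : 𝒢.graph.IsGraph) (R : ChartRepresentatives c) (ι : c.G →* Gtp)
    (hι : Function.Injective ι) (aug : Gtp →* PA) (hexact : ι.range = aug.ker)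
    (hsurj : Function.Surjective aug) {baseAct : PA →* Aut 𝒢.graph}
    (L : ArithLevelData 𝒢.graph (decompositionDataOfChart R ι) aug baseAct)
    {actV : PA → 𝒢.graph.Vertex → 𝒢.graph.Vertex} {actE : PA → 𝒢.graph.Edge → 𝒢.graph.Edge}
    {actB : PA → 𝒢.graph.Branch → 𝒢.graph.Branch} (A : ArithChartAction c ι aug actV actE actB)
    (hest : IsTotallyArithEstranged (decompositionDataOfChart R ι) aug) (hbot : ¬ IsArithAmple aug ⊥)
    (hconjPair : ∀ (b : 𝒢.graph.Branch) (v : 𝒢.graph.Vertex), 𝒢.graph.abuts b = some v →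
      ∃ U : Subgroup PA, IsOpen (U : Set PA) ∧ ∀ a ∈ U, ∃ g : Gtp, aug g = a ∧ ∃ h : c.G,
        conjSubgroup g ((R.Hv v).map ι) = conjSubgroup (ι h) ((R.Hv v).map ι) ∧
          conjSubgroup g ((R.Hb b).map ι) = conjSubgroup (ι h) ((R.Hb b).map ι))
    (hVc : ∀ v, IsCompact (arithVertGp R ι v : Set Gtp))
    (hBc : ∀ b, IsCompact (arithBrGp R ι b : Set Gtp)) :
    ArithMaximalCompactStatementI (decompositionDataOfChart R ι) aug ∧
      ArithMaximalCompactStatementII (decompositionDataOfChart R ι) aug := by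
  have habuts := abut_isSome_of_isGraph R ι hG
  have hιaug : ∀ h : c.G, aug (ι h) = 1 := fun h => by
    rw [← MonoidHom.mem_ker, ← hexact]; exact ⟨h, rfl⟩
  have hR : VerticialEdgeLikeCompactAmpleStatement (decompositionDataOfChart R ι) aug :=
    A.verticialEdgeLikeCompactAmple R hιaug hsurj hG hconjPair hVc hBc
  exact ⟨L.arithMaximalCompactStatementI_of habuts hest hbot,
    L.arithMaximalCompactStatementII_of habuts hest hbot hR
      fun _ hK => not_isEdgeLike_of_isVerticial_ofChart_of_actionAt h h𝒢 hG R ι hι aug hexact A hK⟩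

/-- **[SemiAnbd] Thm 5.4 (i) ∧ (ii) for the produced data, Thm 3.7 (iii) supplied by FINITE-LEVEL DATA**
(print p. 41 "since the semi-graphs `𝔾_j` are all finite"): if finite-level data exist at some chart of `𝒢`
(abc-iut-L3-t10's `FiniteLevelData`, the deliverable of the finite-`𝔾` producer), the umbrella holds with
NO named §3 fact — via abc-iut-w4-d075's bridge `compactInVerticialAt_of_finiteLevelData`.
CONDITIONAL on the packages `L`, `A`, on `hconjPair`, `hVc`, `hBc`, the finite-level data and the print
hypotheses. [cite: MochizukiSemiAnbd2006, Thm 5.4 (i)(ii), p. 66] -/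
theorem arithMaximalCompactStatementI_and_II_ofChart_of_finiteLevelData [T2Space Gtp]
    (hD : ∃ c₀ : TemperedPiChart 𝒢, Nonempty (FiniteLevelData.{v} 𝒢 c₀))
    (h𝒢 : 𝒢.Thm37Hypotheses) (hG : 𝒢.graph.IsGraph) (R : ChartRepresentatives c) (ι : c.G →* Gtp)
    (hι : Function.Injective ι) (aug : Gtp →* PA) (hexact : ι.range = aug.ker)
    (hsurj : Function.Surjective aug) {baseAct : PA →* Aut 𝒢.graph}
    (L : ArithLevelData 𝒢.graph (decompositionDataOfChart R ι) aug baseAct)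
    {actV : PA → 𝒢.graph.Vertex → 𝒢.graph.Vertex} {actE : PA → 𝒢.graph.Edge → 𝒢.graph.Edge}
    {actB : PA → 𝒢.graph.Branch → 𝒢.graph.Branch} (A : ArithChartAction c ι aug actV actE actB)
    (hest : IsTotallyArithEstranged (decompositionDataOfChart R ι) aug) (hbot : ¬ IsArithAmple aug ⊥)
    (hconjPair : ∀ (b : 𝒢.graph.Branch) (v : 𝒢.graph.Vertex), 𝒢.graph.abuts b = some v →
      ∃ U : Subgroup PA, IsOpen (U : Set PA) ∧ ∀ a ∈ U, ∃ g : Gtp, aug g = a ∧ ∃ h : c.G,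
        conjSubgroup g ((R.Hv v).map ι) = conjSubgroup (ι h) ((R.Hv v).map ι) ∧
          conjSubgroup g ((R.Hb b).map ι) = conjSubgroup (ι h) ((R.Hb b).map ι))
    (hVc : ∀ v, IsCompact (arithVertGp R ι v : Set Gtp))
    (hBc : ∀ b, IsCompact (arithBrGp R ι b : Set Gtp)) :
    ArithMaximalCompactStatementI (decompositionDataOfChart R ι) aug ∧
      ArithMaximalCompactStatementII (decompositionDataOfChart R ι) aug :=
  arithMaximalCompactStatementI_and_II_ofChartAt (compactInVerticialAt_of_finiteLevelData hD) h𝒢 hG R ι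
    hι aug hexact hsurj L A hest hbot hconjPair hVc hBc

/-- **Thm 5.4 (ii) alone for the produced data, AT ONE GRAPH** (twin of
`arithMaximalCompactStatementII_ofChart_of_levelData`). [cite: MochizukiSemiAnbd2006, Thm 5.4 (ii), p. 66] -/
theorem arithMaximalCompactStatementII_ofChart_of_levelDataAt [T2Space Gtp] (h : CompactInVerticialAt 𝒢)
    (h𝒢 : 𝒢.Thm37Hypotheses) (hG : 𝒢.graph.IsGraph) (R : ChartRepresentatives c) (ι : c.G →* Gtp)
    (hι : Function.Injective ι) (aug : Gtp →* PA) (hexact : ι.range = aug.ker)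
    (hsurj : Function.Surjective aug) {baseAct : PA →* Aut 𝒢.graph}
    (L : ArithLevelData 𝒢.graph (decompositionDataOfChart R ι) aug baseAct)
    {actV : PA → 𝒢.graph.Vertex → 𝒢.graph.Vertex} {actE : PA → 𝒢.graph.Edge → 𝒢.graph.Edge}
    {actB : PA → 𝒢.graph.Branch → 𝒢.graph.Branch} (A : ArithChartAction c ι aug actV actE actB)
    (hest : IsTotallyArithEstranged (decompositionDataOfChart R ι) aug) (hbot : ¬ IsArithAmple aug ⊥)
    (hconjPair : ∀ (b : 𝒢.graph.Branch) (v : 𝒢.graph.Vertex), 𝒢.graph.abuts b = some v →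
      ∃ U : Subgroup PA, IsOpen (U : Set PA) ∧ ∀ a ∈ U, ∃ g : Gtp, aug g = a ∧ ∃ h : c.G,
        conjSubgroup g ((R.Hv v).map ι) = conjSubgroup (ι h) ((R.Hv v).map ι) ∧
          conjSubgroup g ((R.Hb b).map ι) = conjSubgroup (ι h) ((R.Hb b).map ι))
    (hVc : ∀ v, IsCompact (arithVertGp R ι v : Set Gtp))
    (hBc : ∀ b, IsCompact (arithBrGp R ι b : Set Gtp)) :
    ArithMaximalCompactStatementII (decompositionDataOfChart R ι) aug :=
  (arithMaximalCompactStatementI_and_II_ofChartAt h h𝒢 hG R ι hι aug hexact hsurj L A hest hbot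
    hconjPair hVc hBc).2

end ProfiniteSemiGraph

end Literature.AnabelianGeometry.SemiGraphs
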